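import Summits.BirchSwinnertonDyer.Rank1Residual.ManinAdditive.RamifiedTwistExactDegreeRatio
import Summits.BirchSwinnertonDyer.Rank1Residual.ManinAdditive.RamifiedTwistDegreeTrichotomy
import Summits.BirchSwinnertonDyer.Rank1Residual.ManinAdditive.MinusOneTwistFlat
import Summits.BirchSwinnertonDyer.Rank1Residual.ManinAdditive.RamifiedTwistDegreeDichotomy
import HarnessLib

/-!
# Proved edges among the g1 ramified-twist leaves of cell `bsd-f2-manin` (E-imc-6 / 6ₚ / 7R / 8 / 4)

PROVED implications (no `sorry`, nothing new asserted), copied from the planner-of-record's scratch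
HOME/imc/Sketch-imc-g1.lean (sha16 eda08fcdae877d26, `ramifiedTwistPadicDegreeLaw_of_exactDegreeRatio`,
`degreeDichotomy_of_trichotomy`) and restated over the landed leaves:

* `ramifiedTwistPadicDegreeLaw_of_exactDegreeRatio` : E-imc-6 ⟹ E-imc-6ₚ (take `v_p` of both sides);
* `ramifiedTwistDegreeDichotomy_of_trichotomy` : E-imc-7R ⟹ E-imc-4 (i) (`RamifiedTwistDegreeDichotomy p d`,
  literally the landed g0 leaf; only the degree component of each branch is used, so the edge is the
  same for the repaired form C′);
* `ramifiedTwistDegreeDichotomy_two_negOne_of_minusOneTwistFlat` : E-imc-8 ⟹ E-imc-4 (i) at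
  `(p, d) = (2, −1)` (equal degrees).
-/

noncomputable section

open scoped MatrixGroups ModularForm

open CongruenceSubgroup WeierstrassCurve
  Literature.NumberTheory.EllipticCurves Literature.NumberTheory.EllipticCurves.ModularForms

namespace Summit.BirchSwinnertonDyer.Rank1Residual.ManinAdditive

/-- **E-imc-6 ⟹ E-imc-6ₚ** (apply `padicValNat p` to the exact identity). -/
theorem ramifiedTwistPadicDegreeLaw_of_exactDegreeRatio (p : ℕ) (d : ℤ)
    (h : RamifiedTwistExactDegreeRatio p d) : RamifiedTwistPadicDegreeLaw p d := by
  intro W W' _ _ _ _ _ _ D D' hp hd hD hD' hN hN' htw hirr hniso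
  haveI : Fact p.Prime := ⟨hp⟩
  have key := h W W' D D' hp hd hD hD' hN hN' htw hirr hniso
  have hdeg : D.modularDegree ≠ 0 := D.deg_pos.ne'
  have hdeg' : D'.modularDegree ≠ 0 := D'.deg_pos.ne'
  have hpow : ∀ k : ℕ, (p ^ k : ℕ) ≠ 0 := fun k => pow_ne_zero _ hp.ne_zero
  have e := congrArg (padicValNat p) key
  rw [padicValNat.mul (pow_ne_zero _ hdeg') (hpow _), padicValNat.mul (pow_ne_zero _ hdeg) (hpow _),
    padicValNat.prime_pow, padicValNat.prime_pow, padicValNat.pow, padicValNat.pow] at e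
  omega

/-- **E-imc-7R ⟹ E-imc-4 (i)**: the exact trichotomy implies the valuation dichotomy
`|v_p deg′ − v_p deg| ≤ 1` (the landed leaf `RamifiedTwistDegreeDichotomy p d`). -/
theorem ramifiedTwistDegreeDichotomy_of_trichotomy (p : ℕ) (d : ℤ)
    (h : RamifiedTwistDegreeTrichotomy p d) : RamifiedTwistDegreeDichotomy p d := by
  intro W W' _ _ _ _ _ _ D D' hp hd hD hD' hN hN' htw
  haveI : Fact p.Prime := ⟨hp⟩
  have hdeg : D.modularDegree ≠ 0 := D.deg_pos.ne'
  have hdeg' : D'.modularDegree ≠ 0 := D'.deg_pos.ne'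
  rcases h W W' D D' hp hd hD hD' hN hN' htw with ⟨h1, -⟩ | ⟨h1, -⟩ | h1
  · rw [h1, padicValNat.mul hp.ne_zero hdeg, padicValNat_self]; omega
  · rw [h1, padicValNat.mul hp.ne_zero hdeg', padicValNat_self]; omega
  · rw [h1]; omega

/-- **E-imc-8 ⟹ E-imc-4 (i) at `(2, −1)`**: χ₋₄-flatness gives equal degrees, hence the dichotomy. -/
theorem ramifiedTwistDegreeDichotomy_two_negOne_of_minusOneTwistFlat (h : MinusOneTwistFlat) :
    RamifiedTwistDegreeDichotomy 2 (-1) := by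
  intro W W' _ _ _ _ _ _ D D' _ _ hD hD' hN hN' htw
  have h1 := (h W W' D D' hD hD' hN hN' htw).1
  rw [h1]; omega

end Summit.BirchSwinnertonDyer.Rank1Residual.ManinAdditive

end
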